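import Summits.AtomisticToContinuum.Crystallization.Theorems.CoarseGrains.Negative.PredicateAPI

/-!
# `CoarseGrains` / Negative: the radius quantifier is vacuous below `97/200`

Negative knowledge for crux `stmt-AtomisticToContinuum-9331` (`ExcessDecayLiouville.CoarseGrains`),
standing crux-disprover seat `refuter-cdisprove-stmt-AtomisticToContinuum-9331-0` (2026-08-16); builds
on `Negative.PredicateAPI`.  Nothing here closes an item; no theorem concludes a Theses decl
(`CoarseGrains` is the `∀ R` statement; here only its matrix at small `R` is settled, for ALL
configurations).

* `near_trivial_of_lt`: for `R < 97/200` and every bounded `X ⊆ ℝ³` there is an admissible datum with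
  hcp-like inner displacement two-way `1/40`-matched with `X` on some `B_R(c)` — vacuously: the datum
  `0.97·id` is parked farther than `R` from `X` and the ball is centred at a bond midpoint, which is
  `≥ 97/200` from every site (sublattice 0: `|i + j/2 − 1/2| ≥ 1/2` or `|j|√3/2 ≥ 1/2`; sublattice 1: the
  height is an odd multiple of `0.97·√(2/3)`).  With an octahedral-hole centre the same works up to
  `R < 0.97/√2 ≈ 0.686`; genuine content starts at `R ≈ 1`.
* `coarseGrains_matrix_of_lt`: hence the matrix of the crux holds at every `R < 97/200` for every finite
  configuration, ground state or not (provers may take `N₀ := 0` there).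
-/

noncomputable section

open Literature.MathematicalPhysics.StatisticalMechanics

namespace Summit.AtomisticToContinuum.Crystallization.Theorems.CoarseGrains.Negative.RadiusVacuity

open Summit.AtomisticToContinuum.Crystallization.Theorems.CoarseGrains.Negative.PredicateAPI

/-- `1/2 ≤ √(2/3)`. [folklore] -/
theorem half_le_sqrt23 : (1 : ℝ) / 2 ≤ Real.sqrt (2 / 3) := by
  nlinarith [sqrt23_sq, Real.sqrt_nonneg (2 / 3 : ℝ)]

/-- For `R < 97/200` the conclusion of `CoarseGrains` holds for EVERY bounded set `X` (in particular for
every finite configuration, ground state or not): take the isotropic datum `A = 0.97·id`, put its origin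
`t 0` farther than `R` from `X`, and centre the ball at the midpoint `c = t 0 + A(u/2)` of a bond; every
site is `≥ 97/200 > R` away from `c` (sublattice 0: `|i + j/2 − 1/2| ≥ 1/2` or `|j|√3/2 ≥ 1/2`;
sublattice 1: the height is an odd multiple of `0.97·√(2/3)`), and no particle is within `R` of `c`, so
both matching clauses are vacuous.  With `c` at an octahedral hole the same works up to
`R < 0.97/√2 ≈ 0.686`; content starts at `R ≈ 1`. [folklore] -/
theorem near_trivial_of_lt {R : ℝ} (hR : R < 97 / 200) {X : Set E3} (hX : Bornology.IsBounded X) :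
    ∃ (c : E3) (t : Fin 2 → E3) (A : E3 →L[ℝ] E3), Adm A ∧ Inner t A ∧ Near X c R t A (1 / 40) := by
  obtain ⟨M, hMpos, hM⟩ := hX.exists_pos_norm_le
  set u : E3 := triangularVec₁ 1 with hu
  have hu1 : ‖u‖ = 1 := norm_triangularVec₁
  set A : E3 →L[ℝ] E3 := (97 / 100 : ℝ) • ContinuousLinearMap.id ℝ E3 with hAdef
  have hA : ∀ w : E3, A w = (97 / 100 : ℝ) • w := fun w => by simp [hAdef]
  set F : E3 := (M + 1) • u with hF
  set off : E3 := barlowOffset 1 + layerNormal (Real.sqrt (2 / 3)) with hoff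
  set t : Fin 2 → E3 := ![F, F + A off] with ht
  set c : E3 := F + (97 / 200 : ℝ) • u with hc
  have ht0 : t 0 = F := by simp [ht]
  have ht1 : t 1 = F + A off := by simp [ht]
  refine ⟨c, t, A, ?_, ?_, ?_, ?_⟩
  · refine ⟨LinearIsometryEquiv.refl ℝ E3, ?_⟩
    have h0 : A - (97 / 100 : ℝ) •
        ((LinearIsometryEquiv.refl ℝ E3).toContinuousLinearEquiv : E3 →L[ℝ] E3) = 0 := by
      ext w
      simp [hAdef]
    rw [h0, norm_zero]; norm_num
  · change ‖t 1 - t 0 - A off‖ ≤ 1 / 40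
    rw [ht1, ht0]; simp
  · intro p hp hpc
    exfalso
    have hnc : ‖c‖ = M + 1 + 97 / 200 := by
      rw [hc, hF, ← add_smul, norm_smul, hu1, mul_one, Real.norm_eq_abs, abs_of_pos (by linarith)]
    have h1 : ‖c‖ - ‖p‖ ≤ dist p c := by
      rw [dist_comm, dist_eq_norm]; exact norm_sub_norm_le c p
    have h2 := hM p hp
    linarith
  · intro m z hz hzc
    exfalso
    obtain ⟨i, j, k, rfl⟩ := hz
    obtain ⟨h0, h1, h2⟩ := lamVec_apply (i : ℝ) j k
    set zz : E3 := (i : ℝ) • triangularVec₁ 1 + (j : ℝ) • triangularVec₂ 1 +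
      (k : ℝ) • layerNormal (2 * Real.sqrt (2 / 3)) with hzz
    have hF0 : F 0 = M + 1 := by simp [hF, hu, triangularVec₁]
    have hF1 : F 1 = 0 := by simp [hF, hu, triangularVec₁]
    have hF2 : F 2 = 0 := by simp [hF, hu, triangularVec₁]
    have hu0 : u 0 = 1 := by simp [hu, triangularVec₁]
    have hu1' : u 1 = 0 := by simp [hu, triangularVec₁]
    have hu2 : u 2 = 0 := by simp [hu, triangularVec₁]
    have hoff2 : off 2 = Real.sqrt (2 / 3) := by simp [hoff, barlowOffset, layerNormal]
    have hm : m = 0 ∨ m = 1 := by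
      rcases m with ⟨_ | _ | n, hn⟩
      · exact Or.inl rfl
      · exact Or.inr rfl
      · omega
    have hfar : (97 : ℝ) / 200 ≤ dist (t m + A zz) c := by
      rw [dist_eq_norm]
      rcases hm with hm | hm
      · rw [hm, ht0]
        by_cases hj : j = 0
        · have e0 : (F + A zz - c) 0 = (97 / 100) * ((i : ℝ) - 1 / 2) := by
            rw [hc, hA]
            simp only [PiLp.sub_apply, PiLp.add_apply, PiLp.smul_apply, smul_eq_mul]
            rw [h0, hF0, hu0, hj]
            push_cast; ring
          have hi : (1 : ℝ) / 2 ≤ |(i : ℝ) - 1 / 2| := by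
            rcases le_or_gt i 0 with hi0 | hi0
            · have : (i : ℝ) ≤ 0 := by exact_mod_cast hi0
              rw [abs_of_neg (by linarith)]; linarith
            · have : (1 : ℝ) ≤ i := by exact_mod_cast hi0
              rw [abs_of_nonneg (by linarith)]; linarith
          calc (97 : ℝ) / 200 ≤ |(F + A zz - c) 0| := by
                rw [e0, abs_mul, abs_of_pos (by norm_num : (0 : ℝ) < 97 / 100)]; linarith
            _ ≤ _ := abs_apply_le_norm _ 0
        · have e1 : (F + A zz - c) 1 = (97 / 100) * ((j : ℝ) * (Real.sqrt 3 / 2)) := by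
            rw [hc, hA]
            simp only [PiLp.sub_apply, PiLp.add_apply, PiLp.smul_apply, smul_eq_mul]
            rw [h1, hF1, hu1']
            ring
          have hj1 : (1 : ℝ) ≤ |(j : ℝ)| := by
            have : (1 : ℤ) ≤ |j| := Int.one_le_abs hj
            exact_mod_cast this
          calc (97 : ℝ) / 200 ≤ |(F + A zz - c) 1| := by
                rw [e1, abs_mul, abs_of_pos (by norm_num : (0 : ℝ) < 97 / 100), abs_mul,
                  abs_of_pos (by positivity : (0 : ℝ) < Real.sqrt 3 / 2)]
                have hs3 : (1 : ℝ) ≤ Real.sqrt 3 := by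
                  nlinarith [Real.sq_sqrt (show (0 : ℝ) ≤ 3 by norm_num), Real.sqrt_nonneg (3 : ℝ)]
                nlinarith [hs3]
            _ ≤ _ := abs_apply_le_norm _ 1
      · rw [hm, ht1]
        have e2 : (F + A off + A zz - c) 2 = (97 / 100) * (Real.sqrt (2 / 3) * (2 * k + 1)) := by
          rw [hc, hA, hA]
          simp only [PiLp.sub_apply, PiLp.add_apply, PiLp.smul_apply, smul_eq_mul]
          rw [h2, hoff2, hF2, hu2]
          ring
        have hk1 : (1 : ℝ) ≤ |(2 * k + 1 : ℝ)| := by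
          have hk : (2 * k + 1 : ℤ) ≠ 0 := by omega
          have : (1 : ℤ) ≤ |2 * k + 1| := Int.one_le_abs hk
          exact_mod_cast this
        calc (97 : ℝ) / 200 ≤ |(F + A off + A zz - c) 2| := by
              rw [e2, abs_mul, abs_of_pos (by norm_num : (0 : ℝ) < 97 / 100), abs_mul,
                abs_of_nonneg (Real.sqrt_nonneg _)]
              nlinarith [half_le_sqrt23, Real.sqrt_nonneg (2 / 3 : ℝ)]
          _ ≤ _ := abs_apply_le_norm _ 2
    linarith

/-- Corollary: the matrix of `CoarseGrains` at radius `R < 97/200` holds for every finite configuration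
whatsoever — the radius quantifier carries content only for `R ≳ 1`. [folklore] -/
theorem coarseGrains_matrix_of_lt {R : ℝ} (hR : R < 97 / 200) {N : ℕ} (x : Fin N → E3) :
    ∃ (c : E3) (t : Fin 2 → E3) (A : E3 →L[ℝ] E3), Adm A ∧ Inner t A ∧
      Near (Set.range x) c R t A (1 / 40) :=
  near_trivial_of_lt hR (Set.finite_range x).isBounded


/-! ### Interface sanity: the site set of an admissible datum is uniformly discrete

Together with `exists_site_near` (covering radius `≤ 11/10`) and `le_dist_site_of_ne` (same
sublattice: `≥ 189/200`), the next lemma shows that the sites `t m + A z` of ANY datum with `Adm A`,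
`Inner t A` form a Delone set with separation `≥ 7/10 > 2·(1/40) + 0` — so at tolerance `1/40` the
two-way matching of `Near` is a genuine injective assignment site ↦ particle as soon as particles are
`> 1/20`-separated (ground states are `δ`-separated, `LennardJonesMinimalDistance_holds`): the crux's
interface has no junk model (no collapsed / coincident sites, no empty window). -/

end Summit.AtomisticToContinuum.Crystallization.Theorems.CoarseGrains.Negative.RadiusVacuity

end
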